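import Literature.Probability.Process.PathSpaceTightness
import Mathlib.Topology.UnitInterval
import HarnessLib

/-!
# Tightness in the path space `C([0,1], E)` from moduli of continuity

The unit-time-interval version of `Literature.Probability.Process.isTightMeasureSet_range_map_of_modulus`
(Billingsley, *Convergence of Probability Measures* (2nd ed. 1999), Thm. 7.3, which is stated
for `C[0, 1]`): if the laws of the `Xᵢ(0)` are uniformly tight and for every `ε > 0` and `η > 0`
there is `δ > 0` with `Pᵢ[∃ s, t ∈ [0,1], |s - t| ≤ δ, dist(Xᵢ(s), Xᵢ(t)) ≥ ε] ≤ η` for all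
`i`, then the laws of the random paths `Xᵢ : Ωᵢ → C([0,1], E)` form a tight set of Borel measures
(uniform topology). Deduced from the `C([0, ∞), E)` version through the closed embedding
`C([0,1], E) ↪ C([0,∞), E)`, `p ↦ (t ↦ p(min t 1))` (a closed embedding pulls compact sets back
to compact sets).

* `Literature.Probability.Process.isClosedEmbedding_extendUnitInterval`
* `Literature.Probability.Process.isTightMeasureSet_range_map_of_modulus_unitInterval`

## References

* P. Billingsley, *Convergence of Probability Measures*, 2nd ed. (1999), Thm. 7.3.
-/

noncomputable section

open Set Filter Topology Metric MeasureTheory unitInterval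
open scoped NNReal ENNReal

namespace Literature.Probability.Process

variable {E : Type*} [MetricSpace E]

/-- The clamp `[0, ∞) → [0, 1]`, `t ↦ min t 1`, as a continuous map. [folklore] -/
theorem continuous_projIcc_coe_nnreal :
    Continuous fun t : ℝ≥0 => Set.projIcc (0 : ℝ) 1 zero_le_one (t : ℝ) :=
  continuous_projIcc.comp NNReal.continuous_coe

/-- The inclusion `[0, 1] → [0, ∞)` as a continuous map. [folklore] -/
theorem continuous_unitInterval_toNNReal : Continuous fun s : I => (⟨(s : ℝ), s.2.1⟩ : ℝ≥0) :=
  continuous_subtype_val.subtype_mk _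

/-- **`C([0,1], E) ↪ C([0,∞), E)`, `p ↦ (t ↦ p(min t 1))`, is a closed embedding**: it is
continuous (precomposition), and restriction to `[0,1]` is a continuous left inverse.
[folklore] -/
theorem isClosedEmbedding_extendUnitInterval :
    IsClosedEmbedding fun p : C(I, E) =>
      p.comp ⟨fun t : ℝ≥0 => Set.projIcc (0 : ℝ) 1 zero_le_one (t : ℝ), continuous_projIcc_coe_nnreal⟩ := by
  refine Function.LeftInverse.isClosedEmbedding
    (f := fun q : C(ℝ≥0, E) => q.comp ⟨fun s : I => (⟨(s : ℝ), s.2.1⟩ : ℝ≥0),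
      continuous_unitInterval_toNNReal⟩) (fun p => ?_)
    (ContinuousMap.continuous_precomp _) (ContinuousMap.continuous_precomp _)
  ext s
  change p (Set.projIcc (0 : ℝ) 1 zero_le_one (s : ℝ)) = p s
  rw [Set.projIcc_of_mem zero_le_one s.2]

/-- **Tightness in `C([0,1], E)` from moduli of continuity** (Billingsley's Theorem 7.3): a
family of random paths `Xᵢ : Ωᵢ → C([0,1], E)` on probability spaces `Pᵢ`, `E` proper. Assume
(i) for every `η > 0` there is a compact `K₀ ⊆ E` with `Pᵢ[Xᵢ(0) ∉ K₀] ≤ η` for all `i`;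
(ii) for every `ε > 0` and `η > 0` there is `δ > 0` with
`Pᵢ[∃ s, t ∈ [0,1], |s - t| ≤ δ, ε ≤ dist (Xᵢ s) (Xᵢ t)] ≤ η` for all `i`. Then the laws
`Pᵢ ∘ Xᵢ⁻¹` form a tight set of Borel measures on `C([0,1], E)` (uniform topology).
[cite: Billingsley1999, Thm. 7.3] -/
theorem isTightMeasureSet_range_map_of_modulus_unitInterval [ProperSpace E]
    [MeasurableSpace C(I, E)] [BorelSpace C(I, E)]
    {ι : Type*} {Ω : ι → Type*} [∀ i, MeasurableSpace (Ω i)] {P : ∀ i, Measure (Ω i)}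
    {X : ∀ i, Ω i → C(I, E)}
    (h0 : ∀ η : ℝ≥0∞, 0 < η → ∃ K₀ : Set E, IsCompact K₀ ∧ ∀ i, P i {ω | X i ω 0 ∉ K₀} ≤ η)
    (hmod : ∀ ε : ℝ, 0 < ε → ∀ η : ℝ≥0∞, 0 < η → ∃ δ : ℝ, 0 < δ ∧ ∀ i,
      P i {ω | ∃ s t : I, dist s t ≤ δ ∧ ε ≤ dist (X i ω s) (X i ω t)} ≤ η) :
    IsTightMeasureSet (Set.range fun i ↦ (P i).map (X i)) := by
  letI : MeasurableSpace C(ℝ≥0, E) := borel _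
  haveI : BorelSpace C(ℝ≥0, E) := ⟨rfl⟩
  set F : C(I, E) → C(ℝ≥0, E) := fun p =>
    p.comp ⟨fun t : ℝ≥0 => Set.projIcc (0 : ℝ) 1 zero_le_one (t : ℝ), continuous_projIcc_coe_nnreal⟩
    with hF_def
  have hF : IsClosedEmbedding F := isClosedEmbedding_extendUnitInterval
  have hFm : Measurable F := hF.continuous.measurable
  -- the `C([0,∞), E)` criterion for the extended paths
  have hT : IsTightMeasureSet (Set.range fun i ↦ (P i).map (F ∘ X i)) := by
    refine isTightMeasureSet_range_map_of_modulus (fun η hη => ?_) (fun T ε hε η hη => ?_)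
    · obtain ⟨K₀, hK₀, hK⟩ := h0 η hη
      refine ⟨K₀, hK₀, fun i => ?_⟩
      convert hK i using 3 with ω
      simp [F]
    · obtain ⟨δ, hδ, hP⟩ := hmod ε hε η hη
      refine ⟨δ, hδ, fun i => (measure_mono fun ω => ?_).trans (hP i)⟩
      rintro ⟨s, t, -, -, hst, hε'⟩
      refine ⟨Set.projIcc (0 : ℝ) 1 zero_le_one (s : ℝ), Set.projIcc (0 : ℝ) 1 zero_le_one (t : ℝ),
        ?_, ?_⟩
      · refine le_trans ?_ hst
        rw [Subtype.dist_eq, Real.dist_eq, NNReal.dist_eq]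
        exact Set.abs_projIcc_sub_projIcc zero_le_one
      · simpa [hF_def, F] using hε'
  -- pull back through the closed embedding
  rw [isTightMeasureSet_iff_exists_isCompact_measure_compl_le] at hT ⊢
  intro η hη
  obtain ⟨K, hK, hKP⟩ := hT η hη
  refine ⟨F ⁻¹' K, hF.isCompact_preimage hK, ?_⟩
  rintro _ ⟨i, rfl⟩
  change ((P i).map (X i)) (F ⁻¹' K)ᶜ ≤ η
  by_cases hX : AEMeasurable (X i) (P i)
  swap
  · rw [Measure.map_of_not_aemeasurable hX]
    exact bot_le
  have h := hKP ((P i).map (F ∘ X i)) ⟨i, rfl⟩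
  rw [Measure.map_apply_of_aemeasurable (hFm.comp_aemeasurable hX) hK.isClosed.measurableSet.compl]
    at h
  rw [Measure.map_apply_of_aemeasurable hX (hF.isCompact_preimage hK).isClosed.measurableSet.compl]
  exact h

end Literature.Probability.Process

end
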